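import Summits.HubbardSuperconductivity.HubbardSuperconductivity.Theorems.AnisotropyChordTransferFibre3RowDClosed
import Summits.HubbardSuperconductivity.HubbardSuperconductivity.Theorems.AnisotropyChordTransferFibre3RowDMFormTransform
import Summits.HubbardSuperconductivity.HubbardSuperconductivity.Theorems.AnisotropyChordTransferFibre3RowDConvExpansionU
import Summits.HubbardSuperconductivity.HubbardSuperconductivity.Theorems.AnisotropyChordTransferFibre3RowDSlotSpecs
import Summits.HubbardSuperconductivity.HubbardSuperconductivity.Theorems.AnisotropyChordTransferFibre3RowDTriple
import Summits.HubbardSuperconductivity.HubbardSuperconductivity.Theorems.AnisotropyChordTransferFibre3RowDMonoTransform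
import Summits.HubbardSuperconductivity.HubbardSuperconductivity.Theorems.AnisotropyChordTransferFibre3RowDLowSetExplicit

/-!
# Route `AnisotropyChord` / H0 rotor rung, row D (KT-2a) Stage-1 evaluator: the SPECTATOR-FORM (`M`) monomials, closed part EXACT

Layer D of the row-D program (p1 g29 memo ROWD-DESIGN-g29 §6; layers A–C = `…RowDPairs{,Small}`, `…RowDAtoms`, `…RowDPhase`, `…RowDSlots`,
`…RowDClosed`).  For a monomial `(Fa, Fb, Fc) = (slot k1, slot k2, slot k3)` of `RhatCancelled`, g27's `MFormTransform` writes
`cfgDFT[mform3](k₂,k₃)` as `−½ Σ_{e=±x̂} (e^{iK₁·e} − 1)·[(e^{−i(k₂+k₃)·e} − 1) Π̂(k₂,k₃) + (e^{i(k₂−K₁)·e} − 1) Π̂(k₂−K₁,k₃) + (e^{i(k₃−K₁)·e} − 1) Π̂(k₂,k₃−K₁)]`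
and `Π̂ = tconv(F̂c, F̂a, F̂b) = closedPartU + loopPartU` (`TripleConvolution`, `SlotSpecs`, `FfacDictionary`, `ConvExpansionU`; ★ `dft_slot0`,
★ `piHat_slots`).  Splitting accordingly, ★ `mform_split : cfgDFT[mform3 slots](k₂,k₃) = mClosedU + mLoopU` (semantic, any torus momenta), and
the closed half is an `RExpr` pair: ★ `mTermE k3 k1 k2 k₂ k₃` with ★ `mTermE_eval : V²·t·peval θ xTrueD (mTermE …) = mClosedU … (k̄₂,k̄₃)` at
integer momenta satisfying the decidable side condition `mOk k₂ k₃ = true` (translates in the `|q|∞ ≤ 3` grid, multipliers `|m| ≤ 3`) — the two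
`O(θ)` prefactors are SMALL pairs (`sph m = e^{−iθm} − 1`), their product drops the `t` (`smulS`), the closed convolution is the real `closedM`.
The loop half `mLoopU` (primitives `loopPartU` with the same small prefactors) is majorised in Stage-1b.
Prover seat `hubbard-h0-rotor-p1` g29 (route lead); helper for piece A = stmt-HubbardSuperconductivity-23918 of rung 19089
(`--supports`, helper class).  Nothing here proves superconductivity in the Hubbard model; lemmas for ONE row of ONE conditional reduction;
the rotor TARGET as originally worded stays FALSE (g15 verdict).  Tree imports only; no sorry.
-/

set_option linter.dupNamespace false
set_option autoImplicit false

open Literature.Analysis.ValidatedNumerics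

namespace Summit.HubbardSuperconductivity.HubbardSuperconductivity.Theorems.AnisotropyChord.Transfer.Fibre3

namespace RowD

open RowC L2.N1

variable (L : ℕ) [NeZero L]

/-! ## The slots as uniform specs; `Π̂` of a monomial -/

section semantic
variable (Δ lam2 : ℝ) (f : Tor L → ℝ)

/-- ★ `F̂_slot = F_(psiU kind 1 0 e)` (ground profile, `L ≥ 5`, `0 ≤ Δ < 1`; any `e`). -/
theorem dft_slot0 (hL : 5 ≤ L) (hΔ0 : 0 ≤ Δ) (hΔ1 : Δ < 1) (hf : IsGroundTwoMagnon L Δ lam2 f) (kind : Bool) (e : Tor L) :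
    dft L (slot L Δ f kind) = FfacU L lam2 (psiU L Δ lam2 f kind 1 0 e) := by
  funext q
  obtain ⟨hJ, hS⟩ := slotSpecs_holds L Δ lam2 f hL hΔ0 hΔ1 hf none q
  have hW : Wfac L none q = 1 := rfl
  rw [hW, one_mul] at hJ hS
  cases kind
  · simp only [slot, psiU, if_false, Bool.false_eq_true]
    rw [hJ, (ffacDictionary_holds L lam2 _ _ _ e q).1]
  · simp only [slot, psiU, if_true]
    rw [hS, (ffacDictionary_holds L lam2 _ _ _ e q).1]

/-- ★ `Π̂[slots](q₂,q₃) = closedPartU + loopPartU` of the three unweighted typed specs (`Fc ↦ ψ₃`, `Fa ↦ ψ₁`, `Fb ↦ ψ₂`). -/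
theorem piHat_slots (hL : 5 ≤ L) (hΔ0 : 0 ≤ Δ) (hΔ1 : Δ < 1) (hf : IsGroundTwoMagnon L Δ lam2 f)
    (k3 k1 k2 : Bool) (e : Tor L) (q₂ q₃ : Tor L) :
    cfgDFT L (fun c => ((prod3 L (slot L Δ f k1) (slot L Δ f k2) (slot L Δ f k3) c : ℝ) : ℂ)) q₂ q₃
      = closedPartU L lam2 (psiU L Δ lam2 f k3 1 0 e) (psiU L Δ lam2 f k1 1 0 e) (psiU L Δ lam2 f k2 1 0 e) q₂ q₃
        + loopPartU L lam2 (psiU L Δ lam2 f k3 1 0 e) (psiU L Δ lam2 f k1 1 0 e) (psiU L Δ lam2 f k2 1 0 e) q₂ q₃ := by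
  rw [(tripleConvolution_holds L _ _ _ q₂ q₃).1, dft_slot0 L Δ lam2 f hL hΔ0 hΔ1 hf k1 e,
    dft_slot0 L Δ lam2 f hL hΔ0 hΔ1 hf k2 e, dft_slot0 L Δ lam2 f hL hΔ0 hΔ1 hf k3 e]
  exact convExpansionU_holds L lam2 _ _ _ q₂ q₃

/-- the closed half of `cfgDFT[mform3 slots]`: `MFormTransform`'s combination with `closedPartU` for `Π̂`. -/
noncomputable def mClosedU (k3 k1 k2 : Bool) (e0 : Tor L) (k₂ k₃ : Tor L) : ℂ :=
  -(1 / 2) * (([ex L, -(ex L)] : List (Tor L)).map (fun e =>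
      (phase L (K1 L) e - 1) *
        ( ((starRingEnd ℂ) (phase L (k₂ + k₃) e) - 1)
            * closedPartU L lam2 (psiU L Δ lam2 f k3 1 0 e0) (psiU L Δ lam2 f k1 1 0 e0) (psiU L Δ lam2 f k2 1 0 e0) k₂ k₃
        + (phase L (k₂ - K1 L) e - 1)
            * closedPartU L lam2 (psiU L Δ lam2 f k3 1 0 e0) (psiU L Δ lam2 f k1 1 0 e0) (psiU L Δ lam2 f k2 1 0 e0) (k₂ - K1 L) k₃
        + (phase L (k₃ - K1 L) e - 1)
            * closedPartU L lam2 (psiU L Δ lam2 f k3 1 0 e0) (psiU L Δ lam2 f k1 1 0 e0) (psiU L Δ lam2 f k2 1 0 e0) k₂ (k₃ - K1 L)))).sum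

/-- the loop half of `cfgDFT[mform3 slots]` (the primitives; majorised in Stage-1b). -/
noncomputable def mLoopU (k3 k1 k2 : Bool) (e0 : Tor L) (k₂ k₃ : Tor L) : ℂ :=
  -(1 / 2) * (([ex L, -(ex L)] : List (Tor L)).map (fun e =>
      (phase L (K1 L) e - 1) *
        ( ((starRingEnd ℂ) (phase L (k₂ + k₃) e) - 1)
            * loopPartU L lam2 (psiU L Δ lam2 f k3 1 0 e0) (psiU L Δ lam2 f k1 1 0 e0) (psiU L Δ lam2 f k2 1 0 e0) k₂ k₃
        + (phase L (k₂ - K1 L) e - 1)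
            * loopPartU L lam2 (psiU L Δ lam2 f k3 1 0 e0) (psiU L Δ lam2 f k1 1 0 e0) (psiU L Δ lam2 f k2 1 0 e0) (k₂ - K1 L) k₃
        + (phase L (k₃ - K1 L) e - 1)
            * loopPartU L lam2 (psiU L Δ lam2 f k3 1 0 e0) (psiU L Δ lam2 f k1 1 0 e0) (psiU L Δ lam2 f k2 1 0 e0) k₂ (k₃ - K1 L)))).sum

/-- ★ THE SPLIT: `cfgDFT[mform3 (slot k1) (slot k2) (slot k3)](k₂,k₃) = mClosedU + mLoopU`. -/
theorem mform_split (hL : 5 ≤ L) (hΔ0 : 0 ≤ Δ) (hΔ1 : Δ < 1) (hf : IsGroundTwoMagnon L Δ lam2 f)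
    (k3 k1 k2 : Bool) (e0 : Tor L) (k₂ k₃ : Tor L) :
    cfgDFT L (mform3 L (slot L Δ f k1) (slot L Δ f k2) (slot L Δ f k3)) k₂ k₃
      = mClosedU L Δ lam2 f k3 k1 k2 e0 k₂ k₃ + mLoopU L Δ lam2 f k3 k1 k2 e0 k₂ k₃ := by
  rw [mFormTransform_holds L _ _ _ k₂ k₃]
  unfold mClosedU mLoopU
  simp only [List.map, List.sum_cons, List.sum_nil, piHat_slots L Δ lam2 f hL hΔ0 hΔ1 hf k3 k1 k2 e0]
  ring

end semantic

/-! ## The closed half as an `RExpr` pair -/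

/-- the integer `x̂`. -/
def exI : ℤ × ℤ := (1, 0)

/-- `e^{−iθm} − 1` as a SMALL pair (`|m| ≤ 3`). -/
def sph (m : ℤ) : RExpr × RExpr := sscale (cst (-1)) (swt m)

/-- one `e`-term of the closed half, divided by `V²t`: three translates, each `closedM · smulS(prefactor, prefactor)`. -/
def mTermOne (k3 k1 k2 : Bool) (k₂ k₃ e : ℤ × ℤ) : RExpr × RExpr :=
  padd (padd
    (pscale (closedM k3 k1 k2 k₂ k₃) (smulS (sph (-(qdot exI e))) (sph (qdot (k₂ + k₃) e))))
    (pscale (closedM k3 k1 k2 (k₂ - exI) k₃) (smulS (sph (-(qdot exI e))) (sph (-(qdot (k₂ - exI) e))))))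
    (pscale (closedM k3 k1 k2 k₂ (k₃ - exI)) (smulS (sph (-(qdot exI e))) (sph (-(qdot (k₃ - exI) e)))))

/-- ★ the closed half of `cfgDFT[mform3 slots](k̄₂,k̄₃)` divided by `V²t`, as an ordinary pair. -/
def mTermE (k3 k1 k2 : Bool) (k₂ k₃ : ℤ × ℤ) : RExpr × RExpr :=
  pscale (cst (-1 / 2)) (padd (mTermOne k3 k1 k2 k₂ k₃ (1, 0)) (mTermOne k3 k1 k2 k₂ k₃ (-1, 0)))

/-- admissible point: `0` or in the `|q|∞ ≤ 3` grid. -/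
def okPt (q : ℤ × ℤ) : Bool := decide (q = (0, 0) ∨ q ∈ gridPts 3)

/-- the four points `closedM_eval` needs at momenta `(q₂,q₃)`. -/
def okPair (q₂ q₃ : ℤ × ℤ) : Bool := okPt q₂ && okPt q₃ && okPt (q₂ + q₃) && okPt (-q₂)

/-- ★ the decidable side condition of `mTermE_eval`. -/
def mOk (k₂ k₃ : ℤ × ℤ) : Bool :=
  okPair k₂ k₃ && okPair (k₂ - exI) k₃ && okPair k₂ (k₃ - exI)
  && decide ((qdot (k₂ + k₃) (1, 0)).natAbs ≤ 3) && decide ((qdot (k₂ - exI) (1, 0)).natAbs ≤ 3)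
  && decide ((qdot (k₃ - exI) (1, 0)).natAbs ≤ 3)
  && decide ((qdot (k₂ + k₃) (-1, 0)).natAbs ≤ 3) && decide ((qdot (k₂ - exI) (-1, 0)).natAbs ≤ 3)
  && decide ((qdot (k₃ - exI) (-1, 0)).natAbs ≤ 3)

omit [NeZero L] in
/-- reading `okPt`. -/
theorem okPt_iff (q : ℤ × ℤ) : okPt q = true ↔ (q = (0, 0) ∨ q ∈ gridPts 3) := by
  unfold okPt; exact decide_eq_true_iff

section evals
variable (Δ lam2 : ℝ) (f : Tor L → ℝ)

/-- ★ `sph m ↦ e^{−iθm} − 1` (`|m| ≤ 3`, `L ≥ 3`). -/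
theorem seval_sph (hL : 3 ≤ L) {m : ℤ} (hm : m.natAbs ≤ 3) :
    seval (2 * Real.pi / L) (xTrueD L Δ lam2 f) (sph m)
      = Complex.exp (-(Complex.I * ((2 * Real.pi / L : ℝ) : ℂ) * (m : ℂ))) - 1 := by
  unfold sph
  rw [seval_sscale, seval_swt L Δ lam2 f hL hm]
  simp [cst, RExpr.eval]

/-- `|−m| = |m|` for the side conditions. -/
theorem natAbs_neg_le {m : ℤ} (h : m.natAbs ≤ 3) : (-m).natAbs ≤ 3 := by rwa [Int.natAbs_neg]

/-- the three prefactors at integer momenta as `sph` values: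
`e^{iK₁·ē} − 1`, `e^{−i(k̄₂+k̄₃)·ē} − 1`, `e^{i(q̄ − K₁)·ē} − 1`. -/
theorem prefactors (hL : 3 ≤ L) (e q k₂ k₃ : ℤ × ℤ)
    (h1 : (qdot exI e).natAbs ≤ 3) (h2 : (qdot (k₂ + k₃) e).natAbs ≤ 3) (h3 : (qdot (q - exI) e).natAbs ≤ 3) :
    phase L (K1 L) (B1.toTor L e) - 1 = seval (2 * Real.pi / L) (xTrueD L Δ lam2 f) (sph (-(qdot exI e))) ∧
    (starRingEnd ℂ) (phase L (B1.toTor L k₂ + B1.toTor L k₃) (B1.toTor L e)) - 1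
      = seval (2 * Real.pi / L) (xTrueD L Δ lam2 f) (sph (qdot (k₂ + k₃) e)) ∧
    phase L (B1.toTor L q - K1 L) (B1.toTor L e) - 1 = seval (2 * Real.pi / L) (xTrueD L Δ lam2 f) (sph (-(qdot (q - exI) e))) := by
  refine ⟨?_, ?_, ?_⟩
  · rw [seval_sph L Δ lam2 f hL (natAbs_neg_le h1), K1_eq_toTor, show ((1 : ℤ), (0 : ℤ)) = exI from rfl,
      phase_toTor_E4 L exI e]
    congr 1; push_cast; ring_nf
  · rw [seval_sph L Δ lam2 f hL h2, ← B1.toTor_add, conj_phase_toTor_E4 L (k₂ + k₃) e]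
  · rw [seval_sph L Δ lam2 f hL (natAbs_neg_le h3), K1_eq_toTor, show ((1 : ℤ), (0 : ℤ)) = exI from rfl,
      ← RowC.toTor_sub, phase_toTor_E4 L (q - exI) e]
    congr 1; push_cast; ring_nf

/-- one translate: `prefactor · prefactor · closedPartU(q̄₂,q̄₃) = V²·t·peval(pscale closedM (smulS sph sph))`. -/
theorem translate_eval (hL : 7 ≤ L) (hΔ0 : 0 ≤ Δ) (hΔ1 : Δ < 1) (hf : IsGroundTwoMagnon L Δ lam2 f) (hlam : 0 < lam2)
    (k3 k1 k2 : Bool) (e0 : Tor L) {q₂ q₃ : ℤ × ℤ} (hq : okPair q₂ q₃ = true) (ma mb : ℤ) :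
    seval (2 * Real.pi / L) (xTrueD L Δ lam2 f) (sph ma) * (seval (2 * Real.pi / L) (xTrueD L Δ lam2 f) (sph mb)
      * closedPartU L lam2 (psiU L Δ lam2 f k3 1 0 e0) (psiU L Δ lam2 f k1 1 0 e0) (psiU L Δ lam2 f k2 1 0 e0)
          (B1.toTor L q₂) (B1.toTor L q₃))
      = ((L : ℂ) ^ 2) ^ 2 * ((((2 * Real.pi / L) ^ 2 : ℝ) : ℂ)
          * peval (2 * Real.pi / L) (xTrueD L Δ lam2 f) (pscale (closedM k3 k1 k2 q₂ q₃) (smulS (sph ma) (sph mb)))) := by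
  have hV : ((L : ℂ) ^ 2) ^ 2 ≠ 0 := by
    have : (L : ℂ) ≠ 0 := by exact_mod_cast NeZero.ne L
    positivity
  simp only [okPair, Bool.and_eq_true, okPt_iff] at hq
  obtain ⟨⟨⟨h2, h3⟩, h23⟩, hn2⟩ := hq
  have hc := closedM_eval L Δ lam2 f hL hΔ0 hΔ1 hf hlam k3 k1 k2 e0 e0 e0 h2 h3 h23 hn2
  rw [eq_div_iff hV] at hc
  rw [← hc, peval_pscale]
  have hs := peval_smulS (2 * Real.pi / L) (xTrueD L Δ lam2 f) (xTrueD_zero L Δ lam2 f) (sph ma) (sph mb)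
  linear_combination (-(((L : ℂ) ^ 2) ^ 2 * (((closedM k3 k1 k2 q₂ q₃).eval (xTrueD L Δ lam2 f) : ℝ) : ℂ))) * hs

/-- ★ `V²·t·peval(mTermE) = mClosedU(k̄₂,k̄₃)` (ground profile, `L ≥ 7`, `mOk k₂ k₃`). -/
theorem mTermE_eval (hL : 7 ≤ L) (hΔ0 : 0 ≤ Δ) (hΔ1 : Δ < 1) (hf : IsGroundTwoMagnon L Δ lam2 f) (hlam : 0 < lam2)
    (k3 k1 k2 : Bool) (e0 : Tor L) {k₂ k₃ : ℤ × ℤ} (hok : mOk k₂ k₃ = true) :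
    ((L : ℂ) ^ 2) ^ 2 * ((((2 * Real.pi / L) ^ 2 : ℝ) : ℂ)
        * peval (2 * Real.pi / L) (xTrueD L Δ lam2 f) (mTermE k3 k1 k2 k₂ k₃))
      = mClosedU L Δ lam2 f k3 k1 k2 e0 (B1.toTor L k₂) (B1.toTor L k₃) := by
  have hL3 : 3 ≤ L := by omega
  simp only [mOk, Bool.and_eq_true, decide_eq_true_eq] at hok
  obtain ⟨⟨⟨⟨⟨⟨⟨⟨hp0, hp1⟩, hp2⟩, m1p⟩, m2p⟩, m3p⟩, m1n⟩, m2n⟩, m3n⟩ := hok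
  have hx1 : (qdot exI (1, 0)).natAbs ≤ 3 := by decide
  have hxn : (qdot exI (-1, 0)).natAbs ≤ 3 := by decide
  obtain ⟨pa, pb, pc⟩ := prefactors L Δ lam2 f hL3 (1, 0) k₂ k₂ k₃ hx1 m1p m2p
  obtain ⟨-, -, pd⟩ := prefactors L Δ lam2 f hL3 (1, 0) k₃ k₂ k₃ hx1 m1p m3p
  obtain ⟨na, nb, nc⟩ := prefactors L Δ lam2 f hL3 (-1, 0) k₂ k₂ k₃ hxn m1n m2n
  obtain ⟨-, -, nd⟩ := prefactors L Δ lam2 f hL3 (-1, 0) k₃ k₂ k₃ hxn m1n m3n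
  obtain ⟨hex, hnex, -⟩ := toTor_named L
  -- the translated momenta on the torus
  have ht2 : B1.toTor L k₂ - K1 L = B1.toTor L (k₂ - exI) := by rw [K1_eq_toTor, ← RowC.toTor_sub]; rfl
  have ht3 : B1.toTor L k₃ - K1 L = B1.toTor L (k₃ - exI) := by rw [K1_eq_toTor, ← RowC.toTor_sub]; rfl
  unfold mClosedU
  rw [← hnex, ← hex]
  simp only [List.map, List.sum_cons, List.sum_nil, add_zero]
  rw [pa, pb, pc, pd, na, nb, nc, nd, ht2, ht3]
  -- each of the six products
  have e1 := translate_eval L Δ lam2 f hL hΔ0 hΔ1 hf hlam k3 k1 k2 e0 hp0 (-(qdot exI (1, 0))) (qdot (k₂ + k₃) (1, 0))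
  have e2 := translate_eval L Δ lam2 f hL hΔ0 hΔ1 hf hlam k3 k1 k2 e0 hp1 (-(qdot exI (1, 0))) (-(qdot (k₂ - exI) (1, 0)))
  have e3 := translate_eval L Δ lam2 f hL hΔ0 hΔ1 hf hlam k3 k1 k2 e0 hp2 (-(qdot exI (1, 0))) (-(qdot (k₃ - exI) (1, 0)))
  have f1 := translate_eval L Δ lam2 f hL hΔ0 hΔ1 hf hlam k3 k1 k2 e0 hp0 (-(qdot exI (-1, 0))) (qdot (k₂ + k₃) (-1, 0))
  have f2 := translate_eval L Δ lam2 f hL hΔ0 hΔ1 hf hlam k3 k1 k2 e0 hp1 (-(qdot exI (-1, 0))) (-(qdot (k₂ - exI) (-1, 0)))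
  have f3 := translate_eval L Δ lam2 f hL hΔ0 hΔ1 hf hlam k3 k1 k2 e0 hp2 (-(qdot exI (-1, 0))) (-(qdot (k₃ - exI) (-1, 0)))
  simp only [mul_add]
  rw [e1, e2, e3, f1, f2, f3]
  unfold mTermE mTermOne
  rw [peval_pscale, peval_padd, peval_padd, peval_padd, peval_padd, peval_padd]
  simp only [cst, RExpr.eval]
  push_cast
  ring

end evals

end RowD

end Summit.HubbardSuperconductivity.HubbardSuperconductivity.Theorems.AnisotropyChord.Transfer.Fibre3
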